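import Literature.Analysis.FluidPDE.TaoH1FourierDecomposition
import HarnessLib

/-!
# Tao (2011/2013), Thm. 5.4 (ii)+(iv) on the Fourier side: the `H¹`-mild interface and the
# assembly of `tao2011_fourier_local_existence`

Second file of the discharge of `Literature.Analysis.FluidPDE.tao2011_fourier_local_existence`
(`TaoH1FourierDecomposition.lean`; T. Tao, *Localisation and compactness properties of the
Navier–Stokes global regularity problem*, Anal. PDE 6 (2013) = arXiv:1108.1165, Thm. 5.4 = arXiv
Thm. 31, p. 18). Tao's proof of (ii) (p. 18: "repeating the proof of Theorem 28 verbatim", i.e.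
the Picard iteration of p. 16 for the Duhamel formula in `X¹ = L^∞_t H¹_x ∩ L²_t H²_x` with the
energy estimate (energy-duh2) and the bilinear estimate (bilinear-2) of Lemma 23, p. 10) and of
(iv) (p. 18: `u ∈ X^k` for all `k`, then `p`, `∂ₜu ∈ L^∞_t H^k_x` by Sobolev embedding in the
equation) is run in the tree on the Fourier side: the solution is `u(t) = synthVel (v t) = Re 𝓕 v(t)`
where `v` is a fixed point of the transformed Duhamel map `FourierNS.duhamel c T a`
(`NSFourierPicard`), `c = 4π²ν`, now for data `a` in the weighted-`L²` class
`IsSobolevFourierDatum` (all moments `∫ (1 + ‖ξ‖)^{2k} |a|² < ∞`) instead of the pointwise class of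
the tree's `FourierDatum`.

This file fixes the **interface** between the two halves of that argument and proves the
assembly:

* `FourierNS.IsSobolevMild c T a v` — `v : ℝ → E → ℂ^ι` is a Fourier-side mild solution on
  `[0, T]` from the datum `a`: measurable time slices, continuity in time at every frequency, the
  fixed-point identity `v = duhamel c T a v` (time clamped to `[0, T]`), pointwise polynomial decay
  of every order of the Duhamel part `v(t) − e^{-c‖ξ‖² t} a` uniformly in time, the divergence-free
  symbol relation and the conjugation symmetry;
* `tao2011_sobolevMild_exists` — **Thm. 5.4 (ii), Fourier side** (named fact): under
  `(∫ (1 + 4π²‖ξ‖²)|a|²)² T ≤ c₀ ν³` such a `v` exists on `[0, T]` (for a Borel measurable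
  representative `a` of the datum);
* `sobolevMild_classical` — **Thm. 5.4 (iv) with (i), Fourier side** (named fact): the synthesis
  `u(t) = synthVel (v t)` of an `IsSobolevMild` solution with `IsSobolevFourierDatum` datum is, with
  the pressure `Re 𝓕 presSymbol (v t) (v t)`, a classical solution on the closed slab `[0, T] × ℝ³`
  with `u 0 = synthVel a`, `u, ∂ₜu, p ∈ L^∞_t H^k_x` for all `k` and `u ∈ C([0, T]; L²)`;
* `IsSobolevFourierDatum.exists_measurable_repr` (proved) — every datum of Sobolev class is a.e.
  equal to a Borel measurable one of the same class with the same synthesis and the same `H¹`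
  quantity (symmetrise an a.e. representative under `ξ ↦ -ξ` and conjugation, then apply the
  Leray projector `z ↦ z − ξ (ξ·z)/‖ξ‖²` frequency-wise);
* `tao2011_fourier_local_existence_of_mild` (proved) — the two facts imply
  `tao2011_fourier_local_existence`.

The two facts are discharged in the files `NSFourierL2*` (existence: the `X¹` contraction in the
homogeneous quantities `sup_t ‖v‖_{L²_ξ}`, `sup_t ‖|ξ| v‖_{L²_ξ}`, `‖|ξ|² v‖_{L²_t L²_ξ}`; synthesis:
`L²`-envelope families and Plancherel). Nothing else is asserted here.

## Mathlib / tree search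

Reused: `FourierNS.duhamel`, `FourierNS.heat`, `FourierNS.clamp`, `FourierNS.nonlin`
(`NSFourierPicard`, `NSFourierBilinear`), `FourierNS.synthVel` (`NSFourierSobolev`),
`FourierNS.IsSobolevFourierDatum`, `fourierH1Sq` (`TaoH1FourierDecomposition`). Mathlib:
`AEStronglyMeasurable.mk`, `Measure.IsNegInvariant`, `quasiMeasurePreserving_neg`,
`integral_congr_ae`, `lintegral_congr_ae`. No Mathlib notion of mild Navier–Stokes solutions.

## References

* T. Tao, arXiv:1108.1165 = Anal. PDE 6 (2013): Thm. 5.4 = arXiv Thm. 31 (p. 18) and its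
  proof; proof of Thm. 28 (p. 16); Lemma 23 (p. 10); `X^s` (p. 9). [Tao2011]
* J. Leray, Acta Math. 63 (1934), §19 (the regular solution synthesized from successive
  approximations). [Leray1934]
-/

noncomputable section

open MeasureTheory Set Function Filter Real Complex FourierTransform
open scoped ENNReal NNReal ContDiff ComplexConjugate FourierTransform
open _root_.Topology

namespace Literature.Analysis.FluidPDE

namespace FourierNS

variable {ι : Type*} [Fintype ι] [DecidableEq ι]

/-- **Fourier-side `H¹`-mild solutions of Sobolev class.** For a heat rate `c` (`= 4π²ν`), a
time `T` and a Fourier datum `a : E → ℂ^ι` (`E = EuclideanSpace ℝ ι`), `v : ℝ → E → ℂ^ι` is a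
mild solution on `[0, T]` of the Fourier-transformed Navier–Stokes system
`∂ₜv = -c‖ξ‖² v − N(v, v)`, `v(0) = a`, in the sense used by the discharge of Tao's Thm. 5.4 on
the Fourier side: the time slices are measurable, `t ↦ v(t, ξ)` is continuous at every
frequency, `v` is a fixed point of the (time-clamped) Duhamel map
`v(t, ξ) = e^{-c‖ξ‖²τ} a(ξ) − ∫₀^τ e^{-c‖ξ‖²(τ-s)} N(v(s), v(s))(ξ) ds`, `τ = clamp T t`
(`FourierNS.duhamel`), the Duhamel part `v(t) − e^{-c‖ξ‖²τ} a` has pointwise polynomial decay of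
every order uniformly in time (it is a time integral of convolutions of weighted-`L²` functions),
and `v` obeys the divergence-free symbol relation and the conjugation symmetry (reality of the
synthesis `Re 𝓕 v(t)`). This is Tao's `H¹` mild solution (Tao 2011, p. 6 and Thm. 5.4) written
for the Fourier transform `v(t) = 𝓕⁻¹u(t)` of the velocity. [cite: Tao2011, Thm. 5.4] -/
structure IsSobolevMild (c T : ℝ) (a : EuclideanSpace ℝ ι → ι → ℂ)
    (v : ℝ → EuclideanSpace ℝ ι → ι → ℂ) : Prop where
  /-- measurable time slices -/
  meas : ∀ t, AEStronglyMeasurable (v t) volume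
  /-- continuity in time at every frequency -/
  cont : ∀ ξ, Continuous fun t => v t ξ
  /-- the fixed-point (Duhamel) identity, time clamped to `[0, T]` -/
  fixed : ∀ t ξ, v t ξ = duhamel c T a v t ξ
  /-- pointwise polynomial decay of every order of the Duhamel part, uniformly in time -/
  decay : ∀ K : ℕ, ∃ B : ℝ, ∀ t ξ, (1 + ‖ξ‖) ^ K * ‖v t ξ - heat c ξ (clamp T t) • a ξ‖ ≤ B
  /-- the divergence-free symbol relation `∑ₗ ξₗ vₗ(t, ξ) = 0` -/
  divFree : ∀ t ξ, ∑ l, ((ξ l : ℝ) : ℂ) * v t ξ l = 0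
  /-- conjugation symmetry (reality of the synthesized velocity) -/
  conjSymm : ∀ t ξ l, v t (-ξ) l = conj (v t ξ l)

omit [Fintype ι] in
/-- An `IsSobolevMild` solution starts at the datum: `v 0 = a` (for `T ≥ 0`). [folklore] -/
theorem IsSobolevMild.apply_zero [Fintype ι] {c T : ℝ} {a : EuclideanSpace ℝ ι → ι → ℂ}
    {v : ℝ → EuclideanSpace ℝ ι → ι → ℂ} (h : IsSobolevMild c T a v) (hT : 0 ≤ T)
    (ξ : EuclideanSpace ℝ ι) : v 0 ξ = a ξ := by
  rw [h.fixed 0 ξ, duhamel_zero hT]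

end FourierNS

open FourierNS

/-- **Tao 2011, Thm. 5.4 (ii) (local existence), Fourier side, weighted-`L²` data.** There is
an absolute constant `c₀ > 0` such that for `ν > 0`, `T > 0` and a Borel measurable Fourier datum
`a : ℝ³ → ℂ³` of Sobolev class (`IsSobolevFourierDatum a`) with
`(∫ (1 + 4π²‖ξ‖²) |a(ξ)|² dξ)² · T ≤ c₀ ν³` (written with a real `A ≥ 0` dominating the
integral; by Plancherel `‖u₀‖⁴_{H¹} T ≤ c₀ ν³`, Tao's hypothesis (D4) of Thm. 5.4 (ii) with `f = 0`
after the footnote-3 rescaling to viscosity `ν`), there is a Fourier-side mild solution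
`v` on `[0, T]` of Sobolev class (`IsSobolevMild (4π²ν) T a v`). In print (arXiv Thm. 31 (ii),
p. 18): "If `(‖u₀‖_{H¹_x(ℝ³)} + ‖f‖_{L¹_t H¹_x(ℝ³)})⁴ T ≤ c` for a sufficiently small absolute
constant `c > 0`, then there exists a `H¹` mild solution `(u, p, u₀, f, T)` with the indicated
data", proved (p. 18, p. 16) by the contraction of the Duhamel map in
`X¹ = L^∞_t H¹_x ∩ L²_t H²_x` via Lemma 23 (p. 10); the discharge runs this iteration for
`v = 𝓕⁻¹u` in the quantities `sup_t ‖v(t)‖_{L²_ξ}`, `sup_t ‖|ξ| v(t)‖_{L²_ξ}`,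
`‖|ξ|² v‖_{L²_t L²_ξ}` and adds the persistence of all moments ((iv): `u ∈ X^k` for all `k`).
Measurability of `a` (rather than a.e. measurability) makes the fixed-point identity meaningful at
every frequency; every datum of Sobolev class has such a representative
(`IsSobolevFourierDatum.exists_measurable_repr`). [cite: Tao2011, Thm. 5.4 (ii)] -/
def tao2011_sobolevMild_exists : Prop :=
  ∃ c₀ : ℝ, 0 < c₀ ∧ ∀ ⦃ν T : ℝ⦄, 0 < ν → 0 < T →
    ∀ ⦃a : EuclideanSpace ℝ (Fin 3) → Fin 3 → ℂ⦄, IsSobolevFourierDatum a → Measurable a →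
      ∀ ⦃A : ℝ⦄, 0 ≤ A → fourierH1Sq a ≤ ENNReal.ofReal A → A ^ 2 * T ≤ c₀ * ν ^ 3 →
        ∃ v : ℝ → EuclideanSpace ℝ (Fin 3) → Fin 3 → ℂ, IsSobolevMild (4 * π ^ 2 * ν) T a v

/-- **Tao 2011, Thm. 5.4 (iv) with (i) (regularity of mild solutions), Fourier side.** For
`ν > 0`, `T > 0`, a Fourier datum `a` of Sobolev class and a Fourier-side mild solution `v` on
`[0, T]` (`IsSobolevMild (4π²ν) T a v`), the synthesized velocity `u(t) = synthVel (v t) = Re 𝓕 v(t)`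
is, together with a pressure `p`, a classical solution of the unforced Navier–Stokes system with
viscosity `ν` on the closed slab `[0, T] × ℝ³` with `u 0 = synthVel a`, and
`u, ∂ₜu, p ∈ L^∞_t H^k_x([0, T] × ℝ³)` for every `k`, `u ∈ C([0, T]; L²)`. In print (arXiv
Thm. 31 (iv), p. 18, with the note closing its proof): "If `(u, p, u₀, f, T, 1)` is a `H¹` mild
solution, and [`u₀ ∈ H^k_x(ℝ³)` for all `k`], then `u` and `p` are smooth; in fact, one has
`∂ₜʲu, ∂ₜʲp ∈ L^∞_t H^k([0, T] × ℝ³)` for all `j, k ≥ 0`" (proof: `u ∈ X^k` for all `k`, then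
(pressure-point) and Sobolev embedding in (ns)); (i): "`u ∈ C⁰_t H¹_x([0, T] × ℝ³)`". On the
Fourier side this is the synthesis of Leray's regular solution (Leray 1934, §19): all moments of
`v(t)` are finite uniformly in time, `∂ₜᵏ v` exist at every frequency with weighted-`L²` envelopes,
so `(t, x) ↦ 𝓕 v(t)(x)` is jointly smooth on the closed slab, the equations hold term by term
(products ↔ convolutions, `∂ ↔ -2πiξ`), and the `L^∞_t H^k_x` bounds are Plancherel.
[cite: Tao2011, Thm. 5.4 (iv)] -/
def sobolevMild_classical : Prop :=
  ∀ ⦃ν T : ℝ⦄, 0 < ν → 0 < T →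
    ∀ ⦃a : EuclideanSpace ℝ (Fin 3) → Fin 3 → ℂ⦄, IsSobolevFourierDatum a →
      ∀ ⦃v : ℝ → EuclideanSpace ℝ (Fin 3) → Fin 3 → ℂ⦄, IsSobolevMild (4 * π ^ 2 * ν) T a v →
        ∃ p : ℝ → EuclideanSpace ℝ (Fin 3) → ℝ,
          FluidPDE.IsClassicalNSSolutionOn (Icc 0 T) ν 0 (fun t => synthVel (v t)) p ∧
          HasBoundedSobolevNormsOn (Icc 0 T) (fun t => synthVel (v t)) ∧
          HasBoundedSobolevNormsOn (Icc 0 T)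
            (FluidPDE.timeDerivWithin (Icc 0 T) (fun t => synthVel (v t))) ∧
          (∀ n : ℕ, ∃ C : ℝ≥0, ∀ t ∈ Icc 0 T, ∫⁻ x, ‖iteratedFDeriv ℝ n (p t) x‖ₑ ^ 2 ≤ C) ∧
          FluidPDE.ContinuousInLpOn (Icc 0 T) 2 (fun t => synthVel (v t))

/-! ### A measurable representative of a datum of Sobolev class -/

namespace FourierNS

variable {ι : Type*} [Fintype ι] [DecidableEq ι] {a : EuclideanSpace ℝ (Fin 3) → Fin 3 → ℂ}

/-- Symmetrisation under `ξ ↦ -ξ` and conjugation of a coefficient field: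
`conjSymmPart b ξ l = (b ξ l + conj (b (-ξ) l)) / 2`. [folklore] -/
def conjSymmPart {ι : Type*} (b : EuclideanSpace ℝ ι → ι → ℂ) (ξ : EuclideanSpace ℝ ι) (l : ι) : ℂ :=
  (b ξ l + conj (b (-ξ) l)) / 2

/-- The frequency-wise Leray projection `z ↦ z − ξ (ξ·z)/‖ξ‖²` of a coefficient field
(value `z` at `ξ = 0`, where Lean's `x / 0 = 0`). [folklore] -/
def lerayPart {ι : Type*} [Fintype ι] (b : EuclideanSpace ℝ ι → ι → ℂ) (ξ : EuclideanSpace ℝ ι)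
    (l : ι) : ℂ :=
  b ξ l - ((ξ l : ℝ) : ℂ) * (∑ k, ((ξ k : ℝ) : ℂ) * b ξ k) / ((‖ξ‖ ^ 2 : ℝ) : ℂ)

omit [DecidableEq ι] in
/-- `∑ₗ ξₗ²` as a complex number is `‖ξ‖²`. [folklore] -/
theorem sum_ofReal_mul_self (ξ : EuclideanSpace ℝ ι) :
    ∑ l, ((ξ l : ℝ) : ℂ) * ((ξ l : ℝ) : ℂ) = ((‖ξ‖ ^ 2 : ℝ) : ℂ) := by
  rw [EuclideanSpace.real_norm_sq_eq, Complex.ofReal_sum]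
  refine Finset.sum_congr rfl fun l _ => ?_
  push_cast
  ring

omit [DecidableEq ι] in
/-- The Leray part is divergence free on the Fourier side: `∑ₗ ξₗ (lerayPart b ξ)ₗ = 0`. [folklore] -/
theorem sum_mul_lerayPart (b : EuclideanSpace ℝ ι → ι → ℂ) (ξ : EuclideanSpace ℝ ι) :
    ∑ l, ((ξ l : ℝ) : ℂ) * lerayPart b ξ l = 0 := by
  unfold lerayPart
  simp_rw [mul_sub, Finset.sum_sub_distrib]
  set S := ∑ k, ((ξ k : ℝ) : ℂ) * b ξ k with hS
  have h1 : ∑ l, ((ξ l : ℝ) : ℂ) * (((ξ l : ℝ) : ℂ) * S / ((‖ξ‖ ^ 2 : ℝ) : ℂ)) =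
      ((‖ξ‖ ^ 2 : ℝ) : ℂ) * S / ((‖ξ‖ ^ 2 : ℝ) : ℂ) := by
    rw [← sum_ofReal_mul_self ξ, Finset.sum_mul, Finset.sum_div]
    refine Finset.sum_congr rfl fun l _ => ?_
    ring
  rw [h1]
  by_cases hξ : ξ = 0
  · subst hξ
    simp [hS]
  · have hn : ((‖ξ‖ ^ 2 : ℝ) : ℂ) ≠ 0 := by
      have : (‖ξ‖ ^ 2 : ℝ) ≠ 0 := by positivity
      exact_mod_cast this
    rw [mul_div_assoc, mul_div_cancel₀ _ hn, sub_self]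

omit [DecidableEq ι] in
/-- If `b` is already divergence free at `ξ` then `lerayPart b ξ = b ξ`. [folklore] -/
theorem lerayPart_eq_self {b : EuclideanSpace ℝ ι → ι → ℂ} {ξ : EuclideanSpace ℝ ι}
    (h : ∑ k, ((ξ k : ℝ) : ℂ) * b ξ k = 0) (l : ι) : lerayPart b ξ l = b ξ l := by
  rw [lerayPart, h, mul_zero, zero_div, sub_zero]

omit [DecidableEq ι] in
/-- Conjugation symmetry of the Leray part of a conjugation-symmetric field. [folklore] -/
theorem lerayPart_neg {b : EuclideanSpace ℝ ι → ι → ℂ} (hb : ∀ ξ l, b (-ξ) l = conj (b ξ l))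
    (ξ : EuclideanSpace ℝ ι) (l : ι) : lerayPart b (-ξ) l = conj (lerayPart b ξ l) := by
  unfold lerayPart
  simp only [hb, PiLp.neg_apply, Complex.ofReal_neg, norm_neg, map_sub, map_mul, map_div₀,
    Complex.conj_ofReal, map_sum]
  have hsum : ∑ x, -((ξ x : ℝ) : ℂ) * conj (b ξ x) = -∑ x, ((ξ x : ℝ) : ℂ) * conj (b ξ x) := by
    rw [← Finset.sum_neg_distrib]
    refine Finset.sum_congr rfl fun x _ => ?_
    ring
  rw [hsum]
  ring

omit [Fintype ι] [DecidableEq ι] in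
/-- The symmetrised field is conjugation symmetric. [folklore] -/
theorem conjSymmPart_neg (b : EuclideanSpace ℝ ι → ι → ℂ) (ξ : EuclideanSpace ℝ ι) (l : ι) :
    conjSymmPart b (-ξ) l = conj (conjSymmPart b ξ l) := by
  unfold conjSymmPart
  simp only [neg_neg, map_div₀, map_add, Complex.conj_conj, map_ofNat]
  ring

/-- **A Borel measurable representative of a datum of Sobolev class.** Every
`IsSobolevFourierDatum a` (a.e. strongly measurable) is a.e. equal to a Borel measurable `a'` of
the same class (same moments, divergence-free symbol relation and conjugation symmetry at *every*
frequency), with the same synthesis `synthVel a' = synthVel a` and the same `H¹` quantity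
`fourierH1Sq a' = fourierH1Sq a`: take a strongly measurable representative `ã`, symmetrise
(`conjSymmPart`) and project (`lerayPart`); on the full-measure set where `ã = a` and `ã(-·) = a(-·)`
this returns `a` by its own symmetry and divergence-freeness. [folklore] -/
theorem IsSobolevFourierDatum.exists_measurable_repr (ha : IsSobolevFourierDatum a) :
    ∃ a' : EuclideanSpace ℝ (Fin 3) → Fin 3 → ℂ, Measurable a' ∧ IsSobolevFourierDatum a' ∧
      a' =ᵐ[volume] a ∧ synthVel a' = synthVel a ∧ fourierH1Sq a' = fourierH1Sq a := by
  set a₁ := ha.meas.mk a with ha₁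
  have hsm : StronglyMeasurable a₁ := ha.meas.stronglyMeasurable_mk
  have hae : a =ᵐ[volume] a₁ := ha.meas.ae_eq_mk
  have hm₁ : Measurable a₁ := hsm.measurable
  set a' : EuclideanSpace ℝ (Fin 3) → Fin 3 → ℂ := lerayPart (conjSymmPart a₁) with ha'
  -- measurability
  have hmS : Measurable (conjSymmPart a₁) := by
    refine measurable_pi_iff.2 fun l => ?_
    have h1 : Measurable fun ξ => a₁ ξ l := (measurable_pi_apply l).comp hm₁
    have h2 : Measurable fun ξ : EuclideanSpace ℝ (Fin 3) => a₁ (-ξ) l := h1.comp measurable_neg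
    exact ((h1.add (Complex.continuous_conj.measurable.comp h2)).div_const 2)
  have hm' : Measurable a' := by
    refine measurable_pi_iff.2 fun l => ?_
    have hSl : ∀ k, Measurable fun ξ => conjSymmPart a₁ ξ k := fun k => (measurable_pi_apply k).comp hmS
    have hc : ∀ k, Measurable fun ξ : EuclideanSpace ℝ (Fin 3) => ((ξ k : ℝ) : ℂ) := fun k =>
      (by fun_prop : Continuous fun ξ : EuclideanSpace ℝ (Fin 3) => ((ξ k : ℝ) : ℂ)).measurable
    have hsum : Measurable fun ξ : EuclideanSpace ℝ (Fin 3) => ∑ k, ((ξ k : ℝ) : ℂ) * conjSymmPart a₁ ξ k :=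
      Finset.measurable_sum _ fun k _ => (hc k).mul (hSl k)
    have hnorm : Measurable fun ξ : EuclideanSpace ℝ (Fin 3) => ((‖ξ‖ ^ 2 : ℝ) : ℂ) :=
      Complex.measurable_ofReal.comp (measurable_norm.pow_const 2)
    exact (hSl l).sub (((hc l).mul hsum).div hnorm)
  -- `a' = a` almost everywhere
  have hae_neg : ∀ᵐ ξ ∂(volume : Measure (EuclideanSpace ℝ (Fin 3))), a (-ξ) = a₁ (-ξ) :=
    (quasiMeasurePreserving_neg volume).ae_eq hae
  have hae' : a' =ᵐ[volume] a := by
    filter_upwards [hae, hae_neg] with ξ h1 h2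
    have hS : conjSymmPart a₁ ξ = a ξ := by
      funext l
      rw [conjSymmPart, ← h1, ← h2, ha.conjSymm ξ l, Complex.conj_conj]
      ring
    funext l
    rw [ha']
    have hdiv : ∑ k, ((ξ k : ℝ) : ℂ) * conjSymmPart a₁ ξ k = 0 := by
      simp_rw [hS]; exact ha.divFree ξ
    rw [lerayPart_eq_self hdiv, hS]
  have hae'l : ∀ l, (fun ξ => a' ξ l) =ᵐ[volume] fun ξ => a ξ l := fun l => by
    filter_upwards [hae'] with ξ h; rw [h]
  -- the class
  have hclass : IsSobolevFourierDatum a' :=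
    { meas := hm'.aestronglyMeasurable
      moments := fun k => by
        have h := ha.moments k
        rwa [← lintegral_congr_ae (show (fun ξ => ENNReal.ofReal ((1 + ‖ξ‖) ^ (2 * k)) *
            ∑ l, ‖a' ξ l‖ₑ ^ 2) =ᵐ[volume] fun ξ => ENNReal.ofReal ((1 + ‖ξ‖) ^ (2 * k)) *
            ∑ l, ‖a ξ l‖ₑ ^ 2 from by filter_upwards [hae'] with ξ h; rw [h])] at h
      divFree := fun ξ => sum_mul_lerayPart _ ξ
      conjSymm := fun ξ l => lerayPart_neg (conjSymmPart_neg a₁) ξ l }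
  refine ⟨a', hm', hclass, hae', ?_, ?_⟩
  · funext x
    ext l
    rw [synthVel_apply, synthVel_apply, Real.fourier_eq, Real.fourier_eq,
      integral_congr_ae (by filter_upwards [hae'l l] with ξ h; rw [h])]
  · unfold fourierH1Sq
    exact lintegral_congr_ae (by filter_upwards [hae'] with ξ h; rw [h])

end FourierNS

/-- **Assembly (proved): Thm. 5.4 (ii) and (iv)+(i) on the Fourier side ⇒
`tao2011_fourier_local_existence`.** Replace the datum by its measurable representative
(`IsSobolevFourierDatum.exists_measurable_repr`: same class, same synthesis, same `H¹` quantity),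
obtain the Fourier-side mild solution `v` on `[0, T]` from `tao2011_sobolevMild_exists` (same
constant `c₀`), and synthesize it with `sobolevMild_classical`; the initial value is
`synthVel (v 0) = synthVel a' = synthVel a`. [cite: Tao2011, Thm. 5.4 (ii)+(iv)] -/
theorem tao2011_fourier_local_existence_of_mild (hE : tao2011_sobolevMild_exists)
    (hS : sobolevMild_classical) : tao2011_fourier_local_existence := by
  obtain ⟨c₀, hc₀, hE⟩ := hE
  refine ⟨c₀, hc₀, fun ν T hν hT a ha A hA hH1 hsmall => ?_⟩
  obtain ⟨a', hm', ha', -, hsynth, hH1eq⟩ := ha.exists_measurable_repr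
  have hH1' : fourierH1Sq a' ≤ ENNReal.ofReal A := hH1eq ▸ hH1
  obtain ⟨v, hv⟩ := hE hν hT ha' hm' hA hH1' hsmall
  obtain ⟨p, hsol, hub, hutb, hpb, huc⟩ := hS hν hT ha' hv
  refine ⟨fun t => synthVel (v t), p, hsol, ?_, hub, hutb, hpb, huc⟩
  change synthVel (v 0) = synthVel a
  rw [← hsynth]
  congr 1
  funext ξ
  exact hv.apply_zero hT.le ξ

end Literature.Analysis.FluidPDE

end
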